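import Literature.MathematicalPhysics.QuantumFieldTheory.Balaban1983to89.B11Eq44COperatorTower

/-!
# `Balaban1983to89.B11Eq44CLetterTower` — T. Bałaban, *The variational problem and background fields in renormalization group method for lattice
gauge theories*, Commun. Math. Phys. **102** (1985) 277–309 [Balaban1985Variational], Sect. C p. 285 (44), (47)–(52), Prop. 3 p. 289, with
[Balaban1985Averaging] (= [4]) Proposition 4 (133)–(135) pp. 38–39: **THE LETTER `C` OF (44) AT `k` AVERAGING LEVELS BETWEEN THE CARRIERS OF (115),
WITH ITS `QuadAnalytic` CLAUSE PROVED, AND THE SECT. C `Regime` OF THE TYPED LETTERS `H`, `C_k` ASSEMBLED** — file 2 of the `k`-level twin of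
`B11Eq44COperatorTorus` (file 1 = `B11Eq44COperatorTower`: the remainder `Cblockk` at a unit bond, (44) against the owner's `QkOfU`, (135) and Prop. 4's
analyticity from the NE7c ∕ lit-balaban crews' theorems, the per-level data of `B9Eq315QTower` discharged from (52))

statement-level skeleton of published theorems with citation tags; proofs where landed; nothing here is a claim about the Yang–Mills mass gap

PDF held: `paper:balaban1985-cmp102-variational-background` (journal page = PDF page + 276); pp. 285–286, 289 as quoted in `B11Eq44COperatorTorus` ∕
`B11Eq174Chart` (render `pub-balaban/b2b-balaban-ref1/pages/1985-cmp102-variational-background/1985-cmp102-variational-background-p009-x2.png`).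

THE PRINT (verbatim, p. 285): *«We consider configurations A′, X with values in the complexified Lie algebra gᶜ, and satisfying |A′| < ε₃(Lʲη)⁻¹ on Ω_j,
X = 0 on Λ₀, |X| < ε₃/B₀ on 𝔅_k. (51) The transformation (50) calculated at such configurations satisfies |C_j(LʲηA′ − LʲηHX)| ≦ C₂(Lʲη|A′| +
Lʲη|HX|)² < 4C₂ε₃², (52)»*; p. 286: *«sup_j L^jη sup_{Ω_j}|A′| = |A′|_{(−1)}»*; p. 289 (Prop. 3): *«for … ε₃ sufficiently small, e.g. 18C₂B₀dc₁(½)ε₃ ≤ 1,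
2ε₃ ≤ c₄»*; [4] p. 39: *«C₂ depends on d and c₄ depends on d and L.»*

DICTIONARY ∕ MODEL READINGS (those of file 1; (M3-k) here).  (M3-k) `k` levels: print's `j` is `k` on every fine bond (`hlev : k ≤ lev₀`; in the
small-field `k`-th step only the level `j = k` survives, (51)'s «X = 0 on Λ₀» is void), so `Lʲη = Lᵏη` and the weight `(L^{lev₀}η)¹ ≥ Lᵏη` of `|·|_{(−1)}`
turns file 1's `C₂·(Lᵏ·sup|ηY|)²` into `C₂‖Y‖²_{(115)}`: pointwise data `≤ r` give `η·sup‖Y‖ ≤ r/Lᵏ` (`eta_mul_norm_le_of_weight_k`).  The radius `c₄` of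
the `quad` slot is a DISPLAYED `ρ` subject to [4] Prop. 4's two smallness conditions `e^{4cα₀}(1 + 8C₁ρ) ≤ 2`, `2ρ ≤ c₃(d,L) = 1/(128(d+1)L)` («c₄ depends
on d and L»); `C₂ = C2T d α₀ = 8C₁e^{4cα₀}` (file 1).

WHAT IS DEFINED AND PROVED (sorry-free; no `Prop` placeholder; no inequality of the paper asserted).
* §5 **`Cck L m η k U lev₀ lev₁ ∇ levB : Space115 L η lev₀ lev₁ ∇ → NegSize L η levB 0 𝔸`** := `B11Eq44QuadLetter.quadOf … (Cblockk …)` — THE LETTER (L5) AT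
  `k` LEVELS (fine index `Bond d (towerP L m k)`, coarse `Bond d m`; `∇`, `lev₁`, `levB` arbitrary); `equiv_Cck_apply` (rfl), `Cck_zero`.
* §6 **`quadAnalytic_Cck : QuadAnalytic (Cck …) (C2T d α₀) ρ`**, **`analyticOnNhd_Cck`** (on `{‖Y‖ < ρ}`), `prop4Hyp_Cck`, `norm_Cck_le_sq` — under `2 ≤ L`,
  file 1's (M2-k) data ([4] Prop. 2: `AvgClosed G`, (52), `C₀α₀ ≤ 1/3`, `4α₀ ≤ c₂′`), `hlev : ∀ b, k ≤ lev₀ b` and the two smallness conditions at `ρ`: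
  the `quad` FIELD of the Sect. C `Regime` and `chart47_spec`'s `hCa` BY NAME at `k` levels (`localQuad_Cblockk`, `localAnalytic_Cblockk`, `smallness_mono`).
* §7 **`regime_sectC_k`** — lit-balaban's Sect. C `Regime (HopAd … U kH) 0 (Cck …) b 0 (C2T d α₀) ρ 0 a_C ε_C` ASSEMBLED from the typed letters at `k`
  levels ((L4) `H` = `B11Eq45HOperator.HopAd` on the finest torus, its (46)-bound from the two row-sum letters of its kernel; (L5) `C_k` with its `quad`
  clause PROVED): displayed remain `0 ≤ b`, the row sums `≤ b`, and the NUMERICAL `dom`∕`self`∕`contr` (the (L7) arithmetic).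
* §8 `quadAnalytic_Cck_one` — NON-VACUITY: at `U ≡ 1` with the unitary group of a C⋆-algebra (print's `U(N)`) (52) holds (`pdev 1̃ = 0`), so §6's hypothesis
  set is inhabited for every admissible `α₀`, `ρ`.
HONEST SCOPE.  Assembly + instantiation; the estimates are the crews' (file 1).  NOT typed here (named): the multi-level reading `lev₀ = levOf Ω k` with
`C_j` on each `Λ_j`, complex backgrounds ([4] Prop. 7), the (L7) arithmetic itself, (L8).  NOT summit progress (cell pub-balaban: NE9 NOT PRINTED ∕ NOT
PROVED, «NE9 ⇐ the named binders»; spine PROVED 0/9; rung (B)+1 on a finite T⁴ — NOT infinite volume, NOT mass gap, NOT Clay).  Filed by the NE9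
crux-team leaf seat `b2b-balaban-t4-ne9-formalise-leaf-03` (gen 55); NEW file; imports `B11Eq44COperatorTower` only; nothing modified.  Net new unproved facts: 0.
-/

noncomputable section

namespace Literature.MathematicalPhysics.QuantumFieldTheory.Balaban1983to89.B11Eq44CLetterTower

open Metric Set B11Eq115Space B11Eq44QuadLetter B11Eq44COperatorTower
open B13Contraction113 (QuadAnalytic)
open B11Prop6Scheme (Prop4Hyp)
open B9Eq315QTorus (perCfg)
open B9Eq315QTower (towerP)
open B9SectCLatticeCarrier (Bond)
open B7Prop2Explicit (pdev AvgClosed C0 c2')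
open B7Prop3Flat (c3)

variable {d : ℕ} {𝔸 : Type*} [NormedRing 𝔸] [NormedAlgebra ℂ 𝔸] [CompleteSpace 𝔸] (L : ℕ) [NeZero L] (m : Fin d → ℕ) [∀ i, NeZero (m i)]
  (η : ℝ) (k : ℕ) (U : Bond d (towerP L m k) → 𝔸ˣ)

/-! ## §5 The letter (L5) at `k` levels: `C_k` between the carriers of (115) -/

section Letter

variable {κ' : Type*} (lev₀ : Bond d (towerP L m k) → ℕ) (lev₁ : κ' → ℕ) (Dc : (Bond d (towerP L m k) → 𝔸) →ₗ[ℂ] (κ' → 𝔸)) (levB : Bond d m → ℕ)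

/-- **THE LETTER `C` OF (44)/(49)–(50) AT `k` LEVELS, AT THE CARRIER** — `Y ↦ C_k(LᵏηY)` from the space (115) of the finest torus `T_{L^k m}` (index
`Bond d (towerP L m k)`, any `∇`, any level maps) to the block-field size space `|·|_{(−0)}` of the unit torus (index `Bond d m` = 𝔅): `quadOf` of `Cblockk`.
The `C` of the Sect. C regime `B11Eq174Chart.Regime H 0 C b 0 C₂ c₄ 0 a_C ε_C` at `k` levels. [cite: Balaban1985Variational, (44) p.285, (47)–(50) p.285] -/
def Cck : Space115 (L : ℝ) η lev₀ lev₁ Dc → NegSize (L : ℝ) η levB 0 𝔸 :=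
  quadOf (levWeight (L : ℝ) η lev₀ 1) (levWeight (L : ℝ) η lev₁ 2) Dc (levWeight (L : ℝ) η levB 0) (Cblockk L m η k U)

/-- Its values are the block values (by `rfl`). [cite: Balaban1985Variational, (44) p.285] -/
@[simp] theorem equiv_Cck_apply (Y : Space115 (L : ℝ) η lev₀ lev₁ Dc) (c : Bond d m) :
    NegSup.equiv _ 𝔸 (Cck L m η k U lev₀ lev₁ Dc levB Y) c = Cblockk L m η k U (JetSup.equiv _ _ Dc Y) c := rfl

/-- `C_k(0) = 0`. [cite: Balaban1985Variational, (55) p.286] -/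
theorem Cck_zero : Cck L m η k U lev₀ lev₁ Dc levB 0 = 0 :=
  quadOf_zero (levWeight (L : ℝ) η lev₀ 1) (levWeight (L : ℝ) η lev₁ 2) Dc (levWeight (L : ℝ) η levB 0) (Cblockk_zero L m η k U)

end Letter

/-! ## §6 The `quad` slot and the analyticity letter at `k` levels, PROVED -/

section Regime

variable [NormOneClass 𝔸] {κ' : Type*} (lev₀ : Bond d (towerP L m k) → ℕ) (lev₁ : κ' → ℕ) (Dc : (Bond d (towerP L m k) → 𝔸) →ₗ[ℂ] (κ' → 𝔸))
  (levB : Bond d m → ℕ) [Fact (0 < η)] (hL : 2 ≤ L) {G : Subgroup 𝔸ˣ} (hG : AvgClosed d L G)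
  (hU : ∀ (x : B7Prop1Explicit.Site d) (κ : Fin d), perCfg (towerP L m k) U x κ ∈ G) {α₀ : ℝ} (hα : 0 < α₀)
  (hα3 : C0 d * α₀ ≤ 1 / 3) (hα4 : 4 * α₀ ≤ c2' d L) (h52 : pdev (perCfg (towerP L m k) U) < α₀ * (((L : ℝ) ^ k)⁻¹) ^ 2)
  (hlev : ∀ b, k ≤ lev₀ b) {ρ : ℝ}
  (hρ : Real.exp (4 * (800 * ((d : ℝ) + 1) ^ 2 * ((d : ℝ) + 4)) * α₀) * (1 + 8 * (131072 * ((d : ℝ) + 1) ^ 2) * ρ) ≤ 2) (hρc : 2 * ρ ≤ c3 d L)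

include hlev in
omit [NormedAlgebra ℂ 𝔸] [CompleteSpace 𝔸] [NormOneClass 𝔸] [NeZero L] [∀ i, NeZero (m i)] [Fact (0 < η)] in
/-- Reading (M3-k): with `k ≤ lev₀` and `1 ≤ L`, the pointwise datum `(L^{j(b)}η)·‖f(b)‖ ≤ r` of `|·|_{(−1)}` gives `η·‖f(b)‖ ≤ r/Lᵏ`.
[cite: Balaban1985Variational, (51) p.285, p.286] -/
theorem eta_mul_norm_le_of_weight_k (hL1 : (1 : ℝ) ≤ L) (hη : 0 ≤ η) (f : Bond d (towerP L m k) → 𝔸) {r : ℝ}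
    (hf : ∀ b, levWeight (L : ℝ) η lev₀ 1 b * ‖f b‖ ≤ r) (b : Bond d (towerP L m k)) : η * ‖f b‖ ≤ r / (L : ℝ) ^ k := by
  rw [le_div_iff₀ (pow_pos (lt_of_lt_of_le one_pos hL1) k)]
  have hw : (L : ℝ) ^ k * η ≤ levWeight (L : ℝ) η lev₀ 1 b := by
    rw [levWeight_apply, pow_one]; exact mul_le_mul_of_nonneg_right (pow_le_pow_right₀ hL1 (hlev b)) hη
  calc η * ‖f b‖ * (L : ℝ) ^ k = ((L : ℝ) ^ k * η) * ‖f b‖ := by ring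
    _ ≤ levWeight (L : ℝ) η lev₀ 1 b * ‖f b‖ := mul_le_mul_of_nonneg_right hw (norm_nonneg _)
    _ ≤ r := hf b

omit [NeZero L] [∀ i, NeZero (m i)] in
/-- [4] Prop. 4's first smallness condition «e^{O(1)2α₀}(1 + 8C₁Lᵏb) ≤ 2» is monotone in the radius. [cite: Balaban1985Averaging, (130)–(133) p.38] -/
theorem smallness_mono {α₀ r ρ : ℝ} (hrρ : r ≤ ρ)
    (hρ : Real.exp (4 * (800 * ((d : ℝ) + 1) ^ 2 * ((d : ℝ) + 4)) * α₀) * (1 + 8 * (131072 * ((d : ℝ) + 1) ^ 2) * ρ) ≤ 2) :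
    Real.exp (4 * (800 * ((d : ℝ) + 1) ^ 2 * ((d : ℝ) + 4)) * α₀) * (1 + 8 * (131072 * ((d : ℝ) + 1) ^ 2) * r) ≤ 2 := by
  refine (mul_le_mul_of_nonneg_left ?_ (Real.exp_pos _).le).trans hρ
  have : 0 ≤ 8 * (131072 * ((d : ℝ) + 1) ^ 2) := by positivity
  nlinarith

include hL hG hU hα hα3 hα4 h52 hlev hρ hρc in
/-- **THE LOCAL WEIGHTED QUADRATIC BOUND of `Cblockk` in (115)-currency**: pointwise `|·|_{(−1)}`-data `≤ r < ρ` ⟹ every block value `≤ C₂·r²` (the `(Lᵏ)²`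
of (135) against the `(Lᵏη)` of the weight — print's «|C_j(LʲηA)| ≦ C₂(Lʲη)²|A|²» read as `≤ C₂|A|²_{(−1)}`).
[cite: Balaban1985Variational, (44) p.285, (52) p.285, (55) p.286; Balaban1985Averaging, (135) p.38] -/
theorem localQuad_Cblockk (f : Bond d (towerP L m k) → 𝔸) (r : ℝ) (hr : 0 ≤ r) (hrρ : r < ρ)
    (hf : ∀ b, levWeight (L : ℝ) η lev₀ 1 b * ‖f b‖ ≤ r) (_hDf : ∀ p, levWeight (L : ℝ) η lev₁ 2 p * ‖Dc f p‖ ≤ r) (c : Bond d m) :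
    levWeight (L : ℝ) η levB 0 c * ‖Cblockk L m η k U f c‖ ≤ C2T d α₀ * r ^ 2 := by
  have hL1 : (1 : ℝ) ≤ L := by exact_mod_cast (le_trans (by norm_num) hL : 1 ≤ L)
  have hLk : (0 : ℝ) < (L : ℝ) ^ k := by positivity
  have hLr : (L : ℝ) ^ k * (r / (L : ℝ) ^ k) = r := mul_div_cancel₀ _ hLk.ne'
  have hη : 0 ≤ η := (Fact.out : 0 < η).le
  have h := norm_Cblockk_le L m η k U hL hG hU hα hα3 hα4 h52 hη f (by positivity)
    (eta_mul_norm_le_of_weight_k L m η k lev₀ hlev hL1 hη f hf) (by rw [hLr]; exact smallness_mono hrρ.le hρ) (by rw [hLr]; linarith) c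
  rw [hLr] at h
  rwa [levWeight_apply, pow_zero, one_mul]

include hL hG hU hα hα3 hα4 h52 hlev hρ hρc in
/-- **[4] Prop. 4's analyticity clause in (115)-currency at `k` levels**: at every flat point whose `|·|_{(−1)}`-data are `< ρ` every block value is
analytic. [cite: Balaban1985Averaging, Proposition 4 p.38; Balaban1985Variational, (44) p.285, p.286] -/
theorem localAnalytic_Cblockk [FiniteDimensional ℂ 𝔸] (f : Bond d (towerP L m k) → 𝔸) (hf : ∀ b, levWeight (L : ℝ) η lev₀ 1 b * ‖f b‖ < ρ)
    (_hDf : ∀ p, levWeight (L : ℝ) η lev₁ 2 p * ‖Dc f p‖ < ρ) (c : Bond d m) :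
    AnalyticAt ℂ (fun g : Bond d (towerP L m k) → 𝔸 => Cblockk L m η k U g c) f := by
  have hL1 : (1 : ℝ) ≤ L := by exact_mod_cast (le_trans (by norm_num) hL : 1 ≤ L)
  have hLk : (0 : ℝ) < (L : ℝ) ^ k := by positivity
  have hLr : (L : ℝ) ^ k * (ρ / (L : ℝ) ^ k) = ρ := mul_div_cancel₀ _ hLk.ne'
  have hη : 0 ≤ η := (Fact.out : 0 < η).le
  -- `0 ≤ ρ`: the fine torus has the bond `(0, c.2)`, whose weighted size is `≥ 0` and `< ρ`
  have hρ0 : 0 ≤ ρ := le_of_lt ((mul_nonneg (levWeight_pos (lt_of_lt_of_le one_pos hL1) (Fact.out : 0 < η) lev₀ 1 _).le (norm_nonneg _)).trans_lt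
    (hf ((fun i => ⟨0, Nat.pos_of_ne_zero (NeZero.ne _)⟩), c.2)))
  exact analyticAt_Cblockk L m η k U hL hG hU hα hα3 hα4 h52 hη f (by positivity)
    (eta_mul_norm_le_of_weight_k L m η k lev₀ hlev hL1 hη f fun b => (hf b).le) (by rw [hLr]; exact hρ) (by rw [hLr]; exact hρc) c

variable [Fintype κ'] [Fact (0 < (L : ℝ))]

include hL hG hU hα hα3 hα4 h52 hlev hρ hρc in
/-- **(44)/(52) FOR THE LETTER at `k` levels**: `‖Y‖_{(115)} < ρ ⇒ ‖C_k(Y)‖_{(−0)} ≤ C₂·‖Y‖²`. [cite: Balaban1985Variational, (44) p.285, (52) p.285] -/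
theorem norm_Cck_le_sq {Y : Space115 (L : ℝ) η lev₀ lev₁ Dc} (hY : ‖Y‖ < ρ) : ‖Cck L m η k U lev₀ lev₁ Dc levB Y‖ ≤ C2T d α₀ * ‖Y‖ ^ 2 :=
  norm_quadOf_le_sq (levWeight (L : ℝ) η lev₀ 1) (levWeight (L : ℝ) η lev₁ 2) Dc (levWeight (L : ℝ) η levB 0) (F := Cblockk L m η k U)
    (C2T_nonneg d α₀) (localQuad_Cblockk L m η k U lev₀ lev₁ Dc levB hL hG hU hα hα3 hα4 h52 hlev hρ hρc) hY

include hL hG hU hα hα3 hα4 h52 hlev hρ hρc in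
/-- **THE ANALYTICITY LETTER `hCa` OF `chart47_spec`** for `C_k`: analytic on `{‖Y‖_{(115)} < ρ}` («an analytic function of A», p. 286; [4] Prop. 4).
[cite: Balaban1985Variational, p.286, (47) p.285; Balaban1985Averaging, Proposition 4 p.38] -/
theorem analyticOnNhd_Cck [FiniteDimensional ℂ 𝔸] :
    AnalyticOnNhd ℂ (Cck L m η k U lev₀ lev₁ Dc levB) {Y : Space115 (L : ℝ) η lev₀ lev₁ Dc | ‖Y‖ < ρ} :=
  analyticOnNhd_quadOf (levWeight (L : ℝ) η lev₀ 1) (levWeight (L : ℝ) η lev₁ 2) Dc (levWeight (L : ℝ) η levB 0) (F := Cblockk L m η k U)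
    (localAnalytic_Cblockk L m η k U lev₀ lev₁ Dc hL hG hU hα hα3 hα4 h52 hlev hρ hρc)

include hL hG hU hα hα3 hα4 h52 hlev hρ hρc in
/-- **`Prop4Hyp` of the letter `C_k`** (lit-balaban's Fréchet form: quadratic bound + `DifferentiableOn ℂ` on the ball).
[cite: Balaban1985Variational, (44) p.285, Prop. 4 (97)–(98) pp.292–293] -/
theorem prop4Hyp_Cck [FiniteDimensional ℂ 𝔸] : Prop4Hyp (Cck L m η k U lev₀ lev₁ Dc levB) (C2T d α₀) ρ :=
  prop4Hyp_quadOf (levWeight (L : ℝ) η lev₀ 1) (levWeight (L : ℝ) η lev₁ 2) Dc (levWeight (L : ℝ) η levB 0) (F := Cblockk L m η k U) (C2T_nonneg d α₀)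
    (localQuad_Cblockk L m η k U lev₀ lev₁ Dc levB hL hG hU hα hα3 hα4 h52 hlev hρ hρc)
    (localAnalytic_Cblockk L m η k U lev₀ lev₁ Dc hL hG hU hα hα3 hα4 h52 hlev hρ hρc)

include hL hG hU hα hα3 hα4 h52 hlev hρ hρc in
/-- **THE `quad` SLOT OF THE SECT. C REGIME FOR THE LETTER (L5) AT `k` LEVELS**: `QuadAnalytic C_k C₂ ρ` with `C₂ = 8C₁e^{4cα₀}` (print's «e^{O(1)2α₀}8C₁»)
and the displayed radius `ρ` («c₄ depends on d and L») — (44)'s two clauses PROVED for the typed `C_k`, ready for `B11Eq174Chart.Regime H 0 (Cck …) b 0 C₂ ρ …`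
∕ `NE9B11ChartAnalytic.chart47_spec`. [cite: Balaban1985Variational, (44) p.285, (49)–(52) p.285, Prop. 3 p.289; Balaban1985Averaging, (133)–(135) p.38, p.39] -/
theorem quadAnalytic_Cck [FiniteDimensional ℂ 𝔸] : QuadAnalytic (Cck L m η k U lev₀ lev₁ Dc levB) (C2T d α₀) ρ :=
  (prop4Hyp_Cck L m η k U lev₀ lev₁ Dc levB hL hG hU hα hα3 hα4 h52 hlev hρ hρc).quadAnalytic

end Regime

/-! ## §7 The Sect. C regime of the typed letters `H` (`B11Eq45HOperator.HopAd`, any lattice) and `C_k` (`Cck`): no `quad` hypothesis left -/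

section SectC

open B11Eq45HOperator (HopAd norm_HopAd_le gradKernel)   open B11Eq115KernelOp (rowSum)   open B11Eq174Chart (Regime)
open B11Eq111FrakG (nabla115)   open B9Eq33CovDerivVector (adTransport)

variable [NormOneClass 𝔸] [FiniteDimensional ℂ 𝔸] (lev₀ : Bond d (towerP L m k) → ℕ) (lev₁ : Bond d (towerP L m k) × Fin d → ℕ) (levB : Bond d m → ℕ)
  [Fact (0 < (L : ℝ))] [Fact (0 < η)] (hL : 2 ≤ L) {G : Subgroup 𝔸ˣ} (hG : AvgClosed d L G)
  (hU : ∀ (x : B7Prop1Explicit.Site d) (κ : Fin d), perCfg (towerP L m k) U x κ ∈ G) {α₀ : ℝ} (hα : 0 < α₀)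
  (hα3 : C0 d * α₀ ≤ 1 / 3) (hα4 : 4 * α₀ ≤ c2' d L) (h52 : pdev (perCfg (towerP L m k) U) < α₀ * (((L : ℝ) ^ k)⁻¹) ^ 2)
  (hlev : ∀ b, k ≤ lev₀ b) {ρ : ℝ}
  (hρ : Real.exp (4 * (800 * ((d : ℝ) + 1) ^ 2 * ((d : ℝ) + 4)) * α₀) * (1 + 8 * (131072 * ((d : ℝ) + 1) ^ 2) * ρ) ≤ 2) (hρc : 2 * ρ ≤ c3 d L)

include hL hG hU hα hα3 hα4 h52 hlev hρ hρc in
/-- **THE SECT. C REGIME OF THE TYPED LETTERS AT `k` LEVELS** (print Prop. 3 p. 289: «for … ε₃ sufficiently small, e.g. 18C₂B₀dc₁(½)ε₃ ≤ 1, 2ε₃ ≤ c₄»; lit-balaban's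
`B11Eq174Chart.Regime H 0 C b 0 C₂ c₄ 0 a_C ε_C`): with `H := HopAd … U kH` ((L4) on the finest torus, its (46)-bound from the two ROW-SUM letters of its kernel)
and `C := Cck …` ((L5) at `k` levels, ITS `quad` CLAUSE PROVED here), the regime holds given `0 ≤ b`, the two row sums `≤ b`, and the NUMERICAL conditions
`dom`/`self`/`contr` on `b`, `C₂ = C2T d α₀`, `c₄ = ρ`, `a_C`, `ε_C` (the (L7) arithmetic, displayed). [cite: Balaban1985Variational, Prop. 3 p.289, (45)–(52) p.285, (54) p.286] -/
theorem regime_sectC_k (kH : Bond d (towerP L m k) → Bond d m → (𝔸 →L[ℂ] 𝔸)) {b aC εC : ℝ} (hb : 0 ≤ b)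
    (h₀ : ∀ x, rowSum (levWeight (L : ℝ) η levB 0) (levWeight (L : ℝ) η lev₀ 1) kH x ≤ b)
    (h₁ : ∀ p, rowSum (levWeight (L : ℝ) η levB 0) (levWeight (L : ℝ) η lev₁ 2) (gradKernel ((η : ℂ)⁻¹) (adTransport U) kH) p ≤ b)
    (hε : 0 ≤ εC) (hdom : 2 * (εC + aC) ≤ ρ) (hself : b * C2T d α₀ * (εC + aC) ^ 2 ≤ εC) (hcontr : 4 * b * C2T d α₀ * (εC + aC) < 1) :
    Regime (HopAd (L : ℝ) η levB lev₀ lev₁ U kH) 0 (Cck L m η k U lev₀ lev₁ (nabla115 η U) levB) b 0 (C2T d α₀) ρ 0 aC εC where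
  norm_G := norm_HopAd_le (L : ℝ) η levB lev₀ lev₁ U hb h₀ h₁
  norm_L := fun Y => by simp
  quad := quadAnalytic_Cck L m η k U lev₀ lev₁ (nabla115 η U) levB hL hG hU hα hα3 hα4 h52 hlev hρ hρc
  B₀_nonneg := hb
  C₄_nonneg := C2T_nonneg d α₀
  θ_nonneg := le_rfl
  ε₄_nonneg := hε
  dom := hdom
  self := by simpa using hself
  contr := by simpa using hcontr

end SectC

/-! ## §8 NON-VACUITY: the flat background `U ≡ 1` with the unitary gauge group meets (M2-k) -/

section NonVacuity

open B7Prop1Explicit (hol stepHol)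
open B7Prop2Explicit (avgClosed_unitaryUnits unitaryUnits)

variable {𝔹 : Type*} [CStarAlgebra 𝔹] [Nontrivial 𝔹] [FiniteDimensional ℂ 𝔹] (L : ℕ) [NeZero L] (m : Fin d → ℕ) [∀ i, NeZero (m i)] (η : ℝ) (k : ℕ)
  {κ' : Type*} [Fintype κ'] (lev₀ : Bond d (towerP L m k) → ℕ) (lev₁ : κ' → ℕ) (Dc : (Bond d (towerP L m k) → 𝔹) →ₗ[ℂ] (κ' → 𝔹)) (levB : Bond d m → ℕ)
  [Fact (0 < (L : ℝ))] [Fact (0 < η)] (hL : 2 ≤ L) {α₀ : ℝ} (hα : 0 < α₀) (hα3 : C0 d * α₀ ≤ 1 / 3) (hα4 : 4 * α₀ ≤ c2' d L) (hlev : ∀ b, k ≤ lev₀ b) {ρ : ℝ}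
  (hρ : Real.exp (4 * (800 * ((d : ℝ) + 1) ^ 2 * ((d : ℝ) + 4)) * α₀) * (1 + 8 * (131072 * ((d : ℝ) + 1) ^ 2) * ρ) ≤ 2) (hρc : 2 * ρ ≤ c3 d L)

omit [Nontrivial 𝔹] [FiniteDimensional ℂ 𝔹] in
/-- Parallel transport (9) of the unit configuration is `1`. [cite: Balaban1985Averaging, (9) p.18] -/
private theorem hol_one : ∀ (x : B7Prop1Explicit.Site d) (w : List (B7Prop1Explicit.Letter d)), hol (1 : B7Prop1Explicit.Site d → Fin d → 𝔹ˣ) x w = 1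
  | _, [] => rfl
  | x, l :: w => by rw [B7Prop1Explicit.hol_cons, hol_one (x + l.vec) w, mul_one]; simp [stepHol]

include hL hα hα3 hα4 hlev hρ hρc in
/-- **NON-VACUITY at the flat background `U ≡ 1`** with print's gauge group `U(N)` (the unitary group of a C⋆-algebra, `B7Prop2Explicit.avgClosed_unitaryUnits`):
(52) holds with `pdev 1̃ = 0`, so the letter `C_k` of the FLAT `k`-step averaging has its `quad` clause for every `α₀ > 0` with `C₀α₀ ≤ 1/3`, `4α₀ ≤ c₂′` and
every radius `ρ` of [4] Prop. 4's smallness — the hypothesis set of §6 is inhabited. [cite: Balaban1985Variational, (44) p.285; Balaban1985Averaging, Proposition 2 p.26] -/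
theorem quadAnalytic_Cck_one :
    QuadAnalytic (Cck L m η k (1 : Bond d (towerP L m k) → 𝔹ˣ) lev₀ lev₁ Dc levB) (C2T d α₀) ρ := by
  have h1 : perCfg (towerP L m k) (1 : Bond d (towerP L m k) → 𝔹ˣ) = 1 := rfl
  have hpdev : pdev (1 : B7Prop1Explicit.Site d → Fin d → 𝔹ˣ) = 0 := by unfold pdev; simp [hol_one]
  have h52 : pdev (perCfg (towerP L m k) (1 : Bond d (towerP L m k) → 𝔹ˣ)) < α₀ * (((L : ℝ) ^ k)⁻¹) ^ 2 := by
    rw [h1, hpdev]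
    have : (0 : ℝ) < L := by exact_mod_cast (lt_of_lt_of_le (by norm_num) hL : 0 < L)
    positivity
  exact quadAnalytic_Cck L m η k 1 lev₀ lev₁ Dc levB hL (avgClosed_unitaryUnits d L) (fun x κ => by rw [h1]; exact one_mem _) hα hα3 hα4 h52 hlev hρ hρc

end NonVacuity

end Literature.MathematicalPhysics.QuantumFieldTheory.Balaban1983to89.B11Eq44CLetterTower

end
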